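import Summits.KontsevichZagierPeriods.KontsevichZagierPeriods.Theorems.PlanarK0Injective.Negative.Kit
import Summits.KontsevichZagierPeriods.KontsevichZagierPeriods.Theorems.PlanarCompiler.Negative.Fold

/-!
# `PlanarCompiler` (stmt-KontsevichZagierPeriods-10058) — negative side VI: the engine's hypotheses are load-bearing (I)

Refuter `cdisprove` (gen 2, cycle 2), written against the registered skeleton of the PICKED line
`twist-restoring-shear` (stub `stub_shearedTransport` = the route support `EqualJacobianTransport`
specialised to the two sheared Lagrangian projections `Ψ₁ = (a, A + λb)`, `Ψ₂ = (b, B + λa)` of a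
closed form `A da + B db`). For each of the three hypotheses of that stub which are not mere typing —
closedness `∂_b A = ∂_a B`, injectivity of `Ψ₂`, injectivity of `Ψ₁` — the stub with the hypothesis
deleted is FALSE, by polynomial data whose two swept regions have different areas (soundness of rule 2).
This file: the common kit (soundness of one rule-2 instance, fibred areas, the double wedge of area `2`)
and `not_shearedTransportWithoutClosed` (`U = (0,1)²`, `A = 2b`, `B = a`, `λ = 0`: both sweeps
injective, twist `2 ≠ 0`, swept regions `(0,1) × (0,2)` and `(0,1)²`, areas `2 ≠ 1`). The two
injectivity hypotheses are treated in `Negative/EngineInjectivity.lean`. So any proof of the stub uses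
all three, and the sign-CAD stub feeding it must really PRODUCE both injectivities.
Builds on the sibling crux's kit (`Theorems/PlanarK0Injective/Negative/Kit.lean`) and on the
fibred-area transport lemmas of `Negative/Fold.lean` (`volume_fibred`, `setIntegral_Ioo_eq_intervalIntegral`).
[Kontsevich–Zagier 2001, §1.2; Arnold 1989, §48]
-/

noncomputable section

open MeasureTheory Set MvPolynomial
open Literature.NumberTheory.Transcendental Literature.ModelTheory.ExponentialFields

namespace Summit.KontsevichZagierPeriods.SymplecticScissors.PlanarCompilerNegative

open Summit.KontsevichZagierPeriods.SymplecticScissors.PlanarK0InjectiveNegative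
  (box mem_box boxRep boxRep_domain boxRep_integrand value_boxRep isSemialgebraic_box isSemialgebraicFunOn_one
   isSemialgebraic_coord_Ioo volume_box_ne_top)

/-! ## §6.0 Common kit: soundness of one rule-2 instance, derivatives of the polynomial data -/

/-- Rule 2 is sound between two representations: a single `changeOfVariablesRel` membership forces
equal values (`KZ.eval_eq_zero_of_mem_changeOfVariablesRel_holds`). [folklore] -/
theorem value_eq_of_sub_mem_cov {r r' : KZ.IntegralRep 2}
    (h : KZ.of r - KZ.of r' ∈ KZ.changeOfVariablesRel) : r.value = r'.value := by
  have h0 := KZ.eval_eq_zero_of_mem_changeOfVariablesRel_holds h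
  rwa [map_sub, KZ.eval_of, KZ.eval_of, sub_eq_zero] at h0

/-- The open unit square `(0,1)²` of the kit as a set. [folklore] -/
theorem mem_unitBox {p : Fin 2 → ℝ} :
    p ∈ (boxRep ![0, 0] ![1, 1]).domain ↔ (0 < p 0 ∧ p 0 < 1) ∧ (0 < p 1 ∧ p 1 < 1) := by
  rw [boxRep_domain, mem_box, Fin.forall_fin_two]
  simp

/-- `fderiv` of the linear datum `A = 2b` in the direction `e₁` is `2`. [folklore] -/
theorem fderiv_two_mul_snd (p : Fin 2 → ℝ) :
    fderiv ℝ (fun q : Fin 2 → ℝ => 2 * q 1) p (Pi.single 1 1) = 2 := by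
  have h : HasFDerivAt (fun q : Fin 2 → ℝ => 2 * q 1)
      ((2 : ℝ) • ContinuousLinearMap.proj (R := ℝ) (φ := fun _ : Fin 2 => ℝ) 1) p :=
    (hasFDerivAt_apply 1 p).const_mul 2
  rw [h.fderiv]
  simp

/-! ## §6.0b The double wedge `{0<x<1, 0<y<2x} ∪ {−1<x<0, 2x<y<0}` (area `2`) -/

/-- `{0 < x < 1, 0 < y < 2x}`. [folklore] -/
def wedgePos : Set (Fin 2 → ℝ) := {q | q 0 ∈ Ioo (0 : ℝ) 1 ∧ 0 < q 1 ∧ q 1 < 2 * q 0}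

/-- `{−1 < x < 0, 2x < y < 0}`. [folklore] -/
def wedgeNeg : Set (Fin 2 → ℝ) := {q | q 0 ∈ Ioo (-1 : ℝ) 0 ∧ 2 * q 0 < q 1 ∧ q 1 < 0}

/-- The double wedge `wedgePos ∪ wedgeNeg` (area `2`). [folklore] -/
def doubleWedge : Set (Fin 2 → ℝ) := wedgePos ∪ wedgeNeg

/-- Area of the positive wedge: `∫₀¹ 2x dx = 1`. [folklore] -/
theorem volume_wedgePos : volume wedgePos = ENNReal.ofReal 1 := by
  have hi : ∫ x in Ioo (0 : ℝ) 1, ((fun x : ℝ => 2 * x) x - (fun _ : ℝ => (0 : ℝ)) x) = 1 := by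
    rw [setIntegral_Ioo_eq_intervalIntegral zero_le_one]
    simp only [sub_zero]
    rw [intervalIntegral.integral_const_mul, integral_id]
    norm_num
  have h := volume_fibred (f := fun _ : ℝ => (0 : ℝ)) (g := fun x : ℝ => 2 * x) (u := 0)
    (v := 1) (by fun_prop) (by fun_prop) (fun x hx => by linarith [hx.1])
  rw [hi] at h
  exact h

/-- Area of the negative wedge: `∫₋₁⁰ (−2x) dx = 1`. [folklore] -/
theorem volume_wedgeNeg : volume wedgeNeg = ENNReal.ofReal 1 := by
  have hi : ∫ x in Ioo (-1 : ℝ) 0, ((fun _ : ℝ => (0 : ℝ)) x - (fun x : ℝ => 2 * x) x) = 1 := by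
    rw [setIntegral_Ioo_eq_intervalIntegral (by norm_num)]
    have hfun : (fun x : ℝ => (fun _ : ℝ => (0 : ℝ)) x - (fun x : ℝ => 2 * x) x) = fun x => (-2) * x := by
      funext x; simp only; ring
    rw [hfun, intervalIntegral.integral_const_mul, integral_id]
    norm_num
  have h := volume_fibred (f := fun x : ℝ => 2 * x) (g := fun _ : ℝ => (0 : ℝ)) (u := -1)
    (v := 0) (by fun_prop) (by fun_prop) (fun x hx => by linarith [hx.2])
  rw [hi] at h
  exact h

/-- The two wedges are disjoint (sign of the abscissa). [folklore] -/
theorem disjoint_wedges : Disjoint wedgePos wedgeNeg := by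
  rw [Set.disjoint_left]
  rintro q ⟨hq, -, -⟩ ⟨hq', -, -⟩
  linarith [hq.1, hq'.2]

/-- The positive wedge is ℚ-semialgebraic (four polynomial inequalities). [folklore] -/
theorem isSemialgebraic_wedgePos : IsSemialgebraic ℚ wedgePos := by
  have h := ((isSemialgebraic_setOf_eval_lt (k := ℚ) (R := ℝ) (ι := Fin 2) (C 0) (X 0)).inter
    (isSemialgebraic_setOf_eval_lt (k := ℚ) (R := ℝ) (ι := Fin 2) (X 0) (C 1))).inter
    ((isSemialgebraic_setOf_eval_lt (k := ℚ) (R := ℝ) (ι := Fin 2) (C 0) (X 1)).inter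
      (isSemialgebraic_setOf_eval_lt (k := ℚ) (R := ℝ) (ι := Fin 2) (X 1) (C 2 * X 0)))
  have key : ∀ S' : Set (Fin 2 → ℝ), IsSemialgebraic ℚ S' → wedgePos = S' → IsSemialgebraic ℚ wedgePos := by
    rintro S' hS rfl; exact hS
  refine key _ h ?_
  ext q
  simp only [wedgePos, mem_setOf_eq, mem_Ioo, mem_inter_iff, map_zero, map_one, aeval_X, map_mul,
    MvPolynomial.aeval_C, eq_ratCast, Rat.cast_ofNat]

/-- The negative wedge is ℚ-semialgebraic (four polynomial inequalities). [folklore] -/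
theorem isSemialgebraic_wedgeNeg : IsSemialgebraic ℚ wedgeNeg := by
  have h := ((isSemialgebraic_setOf_eval_lt (k := ℚ) (R := ℝ) (ι := Fin 2) (C (-1)) (X 0)).inter
    (isSemialgebraic_setOf_eval_lt (k := ℚ) (R := ℝ) (ι := Fin 2) (X 0) (C 0))).inter
    ((isSemialgebraic_setOf_eval_lt (k := ℚ) (R := ℝ) (ι := Fin 2) (C 2 * X 0) (X 1)).inter
      (isSemialgebraic_setOf_eval_lt (k := ℚ) (R := ℝ) (ι := Fin 2) (X 1) (C 0)))
  have key : ∀ S' : Set (Fin 2 → ℝ), IsSemialgebraic ℚ S' → wedgeNeg = S' → IsSemialgebraic ℚ wedgeNeg := by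
    rintro S' hS rfl; exact hS
  refine key _ h ?_
  ext q
  simp only [wedgeNeg, mem_setOf_eq, mem_Ioo, mem_inter_iff, map_zero, aeval_X, map_mul, map_neg, map_one,
    MvPolynomial.aeval_C, eq_ratCast, Rat.cast_ofNat]

/-- The double wedge is ℚ-semialgebraic. [folklore] -/
theorem isSemialgebraic_doubleWedge : IsSemialgebraic ℚ doubleWedge :=
  isSemialgebraic_wedgePos.union isSemialgebraic_wedgeNeg

/-- Area of the double wedge: `1 + 1 = 2`. [folklore] -/
theorem volume_doubleWedge : volume doubleWedge = ENNReal.ofReal 2 := by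
  rw [doubleWedge, measure_union disjoint_wedges (IsSemialgebraic.measurableSet_holds isSemialgebraic_wedgeNeg),
    volume_wedgePos, volume_wedgeNeg, ← ENNReal.ofReal_add zero_le_one zero_le_one]
  norm_num

/-- `[doubleWedge, 1]`: the double wedge as a planar set (value `2`). [folklore] -/
def doubleWedgeRep : KZ.IntegralRep 2 where
  domain := doubleWedge
  integrand := fun _ => 1
  isSemialgebraic_domain := isSemialgebraic_doubleWedge
  isSemialgebraicFunOn_integrand := isSemialgebraicFunOn_one isSemialgebraic_doubleWedge
  integrableOn := integrableOn_const (by rw [volume_doubleWedge]; exact ENNReal.ofReal_ne_top)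

/-- The double wedge has value `2`. [folklore] -/
theorem value_doubleWedgeRep : doubleWedgeRep.value = 2 := by
  rw [KZ.IntegralRep.value, show doubleWedgeRep.integrand = fun _ => (1 : ℝ) from rfl, setIntegral_const,
    smul_eq_mul, mul_one, measureReal_def, show doubleWedgeRep.domain = doubleWedge from rfl,
    volume_doubleWedge, ENNReal.toReal_ofReal zero_le_two]

/-! ## §6.1 Closedness `∂_b A = ∂_a B` is load-bearing

Datum: `U = (0,1)²`, `A = 2b`, `B = a`, `λ = 0` (so `∂_bA = 2 ≠ 1 = ∂_aB`): both sheared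
projections `(a, 2b)` and `(b, a)` are injective, the twist `λ + ∂_bA = 2` never vanishes, and the
swept regions are `(0,1) × (0,2)` (area `2`) and `(0,1)²` (area `1`). -/

/-- `stub_shearedTransport` of the twist-restoring-shear skeleton with the closedness hypothesis
`∀ p ∈ U, fderiv ℝ A p (Pi.single 1 1) = fderiv ℝ B p (Pi.single 0 1)` DELETED (all else verbatim). -/
def ShearedTransportWithoutClosed : Prop :=
  ∀ (U : Set (Fin 2 → ℝ)) (A B : (Fin 2 → ℝ) → ℝ) (lam : ℚ), IsOpen U → IsSemialgebraic ℚ U →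
    IsSemialgebraicFunOn ℚ U A → IsSemialgebraicFunOn ℚ U B → ContDiffOn ℝ 1 A U → ContDiffOn ℝ 1 B U →
    (∀ p ∈ U, (lam : ℝ) + fderiv ℝ A p (Pi.single 1 1) ≠ 0) →
    Set.InjOn (fun p : Fin 2 → ℝ => (![p 0, A p + (lam : ℝ) * p 1] : Fin 2 → ℝ)) U →
    Set.InjOn (fun p : Fin 2 → ℝ => (![p 1, B p + (lam : ℝ) * p 0] : Fin 2 → ℝ)) U →
    ∀ r r' : KZ.IntegralRep 2,
      r.domain = (fun p : Fin 2 → ℝ => (![p 0, A p + (lam : ℝ) * p 1] : Fin 2 → ℝ)) '' U →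
      r'.domain = (fun p : Fin 2 → ℝ => (![p 1, B p + (lam : ℝ) * p 0] : Fin 2 → ℝ)) '' U →
      (∀ q ∈ r.domain, r.integrand q = 1) → (∀ q ∈ r'.domain, r'.integrand q = 1) →
      KZ.of r - KZ.of r' ∈ KZ.changeOfVariablesRel

/-- The vertical sweep of the non-closed datum carries `(0,1)²` onto `(0,1) × (0,2)`. [folklore] -/
theorem image_sweepA_nonClosed :
    (fun p : Fin 2 → ℝ => (![p 0, 2 * p 1 + ((0 : ℚ) : ℝ) * p 1] : Fin 2 → ℝ)) ''
      (boxRep ![0, 0] ![1, 1]).domain = (boxRep ![0, 0] ![1, 2]).domain := by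
  ext q
  simp only [mem_image, boxRep_domain, mem_box, Fin.forall_fin_two, Rat.cast_zero, zero_mul,
    add_zero]
  constructor
  · rintro ⟨p, ⟨h0, h1⟩, rfl⟩
    simp only [Matrix.cons_val_zero, Matrix.cons_val_one] at h0 h1 ⊢
    push_cast at h0 h1 ⊢
    exact ⟨h0, by constructor <;> linarith [h1.1, h1.2]⟩
  · rintro ⟨h0, h1⟩
    simp only [Matrix.cons_val_zero, Matrix.cons_val_one] at h0 h1
    push_cast at h0 h1
    refine ⟨![q 0, q 1 / 2], ?_, ?_⟩
    · simp only [Matrix.cons_val_zero, Matrix.cons_val_one]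
      push_cast
      exact ⟨h0, by constructor <;> linarith [h1.1, h1.2]⟩
    · ext i
      fin_cases i
      · simp
      · simp; ring

/-- The horizontal sweep of the non-closed datum carries `(0,1)²` onto itself (the swap). [folklore] -/
theorem image_sweepB_nonClosed :
    (fun p : Fin 2 → ℝ => (![p 1, p 0 + ((0 : ℚ) : ℝ) * p 0] : Fin 2 → ℝ)) ''
      (boxRep ![0, 0] ![1, 1]).domain = (boxRep ![0, 0] ![1, 1]).domain := by
  ext q
  simp only [mem_image, boxRep_domain, mem_box, Fin.forall_fin_two, Rat.cast_zero, zero_mul,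
    add_zero]
  constructor
  · rintro ⟨p, ⟨h0, h1⟩, rfl⟩
    simp only [Matrix.cons_val_zero, Matrix.cons_val_one] at h0 h1 ⊢
    exact ⟨h1, h0⟩
  · rintro ⟨h0, h1⟩
    refine ⟨![q 1, q 0], ?_, ?_⟩
    · simp only [Matrix.cons_val_zero, Matrix.cons_val_one] at h0 h1 ⊢
      exact ⟨h1, h0⟩
    · ext i
      fin_cases i <;> simp

/-- LOAD-BEARING (closedness): `stub_shearedTransport` without `∂_bA = ∂_aB` is FALSE. [folklore] -/
theorem not_shearedTransportWithoutClosed : ¬ ShearedTransportWithoutClosed := by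
  intro h
  have hU : IsSemialgebraic ℚ (boxRep ![0, 0] ![1, 1]).domain := (boxRep ![0, 0] ![1, 1]).isSemialgebraic_domain
  have hopen : IsOpen (boxRep ![0, 0] ![1, 1]).domain := by
    rw [boxRep_domain]; exact isOpen_set_pi finite_univ fun _ _ => isOpen_Ioo
  have hA : IsSemialgebraicFunOn ℚ (boxRep ![0, 0] ![1, 1]).domain (fun q : Fin 2 → ℝ => 2 * q 1) :=
    (isSemialgebraicFunOn_aeval hU (C 2 * X 1)).congr fun p _ => by simp
  have hB : IsSemialgebraicFunOn ℚ (boxRep ![0, 0] ![1, 1]).domain (fun q : Fin 2 → ℝ => q 0) :=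
    (isSemialgebraicFunOn_aeval hU (X 0)).congr fun p _ => by simp
  have hcA : ContDiffOn ℝ 1 (fun q : Fin 2 → ℝ => 2 * q 1) (boxRep ![0, 0] ![1, 1]).domain :=
    (contDiff_const.mul (contDiff_apply ℝ ℝ 1)).contDiffOn
  have hcB : ContDiffOn ℝ 1 (fun q : Fin 2 → ℝ => q 0) (boxRep ![0, 0] ![1, 1]).domain :=
    (contDiff_apply ℝ ℝ 0).contDiffOn
  have htw : ∀ p ∈ (boxRep ![0, 0] ![1, 1]).domain,
      ((0 : ℚ) : ℝ) + fderiv ℝ (fun q : Fin 2 → ℝ => 2 * q 1) p (Pi.single 1 1) ≠ 0 := by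
    intro p _
    rw [fderiv_two_mul_snd]
    norm_num
  have hi₁ : Set.InjOn (fun p : Fin 2 → ℝ => (![p 0, 2 * p 1 + ((0 : ℚ) : ℝ) * p 1] : Fin 2 → ℝ))
      (boxRep ![0, 0] ![1, 1]).domain := by
    intro p _ q _ hpq
    have h0 := congr_fun hpq 0
    have h1 := congr_fun hpq 1
    simp at h0 h1
    ext i; fin_cases i
    · exact h0
    · simpa using h1
  have hi₂ : Set.InjOn (fun p : Fin 2 → ℝ => (![p 1, p 0 + ((0 : ℚ) : ℝ) * p 0] : Fin 2 → ℝ))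
      (boxRep ![0, 0] ![1, 1]).domain := by
    intro p _ q _ hpq
    have h0 := congr_fun hpq 0
    have h1 := congr_fun hpq 1
    simp at h0 h1
    ext i; fin_cases i
    · exact h1
    · simpa using h0
  have hmem := h _ _ _ 0 hopen hU hA hB hcA hcB htw hi₁ hi₂ (boxRep ![0, 0] ![1, 2])
    (boxRep ![0, 0] ![1, 1]) image_sweepA_nonClosed.symm image_sweepB_nonClosed.symm
    (fun _ _ => rfl) (fun _ _ => rfl)
  have hv := value_eq_of_sub_mem_cov hmem
  rw [value_boxRep (by intro i; fin_cases i <;> norm_num),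
    value_boxRep (by intro i; fin_cases i <;> norm_num)] at hv
  norm_num at hv


end Summit.KontsevichZagierPeriods.SymplecticScissors.PlanarCompilerNegative
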